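import Literature.AnabelianGeometry.EtaleTheta.Discharge.Sec1Thm110MatchingOfDeck
import Literature.AnabelianGeometry.EtaleTheta.Discharge.Sec1AnchoredTranslatePoints
import HarnessLib

/-!
# [EtTh] §1: anchored standard data WITH the deck relation from ONE anchored point and a deck element
# (K2 ↔ R78 junction; abc-iut-w5-d140)

S. Mochizuki, *The étale theta function …*, Publ. RIMS 45 (2009), §1, Prop. 1.4 (iii) p.248, Def. 1.9 p.255
[cite: MochizukiEtTh2009, Def 1.9 p.29].  PROOF-ONLY sequel of abc-iut-L2-d1's
`Sec1AnchoredTranslatePoints.lean` (p423491: `exists_anchoredPoint_translates_of_prop15ii` — ANCHORED points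
on conjugate decomposition groups, injective conjugation transport), abc-iut-L2-t1's
`ThetaCohomologyAnchored.lean` (p421374) and this seat's `Sec1Thm110iUniqueDeck.lean` (p425484) /
`Sec1Thm110MatchingOfDeck.lean` (p430193).  K2 holder abc-iut-w5-d140; written for the R78 value layer
(abc-iut-L2-t6 g5's section-points, p430358): it reduces «anchored standard data with the deck relation» —
the data over which ALL K2 routes (p425484, p428966, p429307, p430193) quantify — to ONE anchored point `τ`
with `Ü(τ) = √−1 ∈ K`, ONE `ε ∈ Π^tp_X`, Prop. 1.5 (ii), and the class identity `ε·log(Ü) = log(Ü)·κ(−1)`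
(«the deck transformation negates `Ü`»; then `τ⁻¹ := ε⁻¹·τ` is d1's anchored translate with `u₁ = −1`):
* `MuTwoSetting.exists_anchoredStandardData_of_deck` — `∃ A : AnchoredStandardData E, A.tau = τ ∧
  A.sqrtNegOne = √−1 ∧ A.tauInv.Dpt = ε⁻¹ D_τ ε`;
* `MuTwoSetting.exists_thm110iUnique_of_anchoredPoint_of_deck` — with `toZ ε = 0` and Prop. 1.5 (iii):
  [EtTh] Thm. 1.10 (i) «up to ±1» for these data (r8″).
HONEST FRAMING: constructions relative to the interface (`Prop15ii` BY NAME); nothing of [EtTh] asserted; no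
side taken on [IUTchIII] Cor. 3.12.
-/

noncomputable section

namespace Literature.AnabelianGeometry.EtaleTheta

open Literature.AnabelianGeometry.SemiGraphs

namespace MuTwoSetting

variable {p : ℕ} [Fact p.Prime] {M : MuTwoSetting p}

/-- The coordinates `Ü(τ)·(−1)^a = ±√−1` are off the cusps `±q̈^ℤ` (because `√−1` is).
[cite: MochizukiEtTh2009, Def 1.9 p.29] -/
theorem coord_mul_neg_one_zpow_ne_cusp {E : M.toThetaSetting.KummerData}
    (τ : ThetaSetting.NonCuspidalPoint E) (a b : ℤ) :
    (((τ.coord * (-1) ^ a : (↥M.Kdd)ˣ) : M.Kdd) : PadicAlgCl p) ≠ M.toThetaSetting.qdd ^ b ∧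
      (((τ.coord * (-1) ^ a : (↥M.Kdd)ˣ) : M.Kdd) : PadicAlgCl p) ≠ -(M.toThetaSetting.qdd ^ b) := by
  obtain ⟨h1, h2⟩ := τ.coord_ne_cusp b
  rcases Int.even_or_odd a with ha | ha
  · rw [ha.neg_one_zpow, mul_one]
    exact ⟨h1, h2⟩
  · rw [ha.neg_one_zpow]
    have hcoe : (((τ.coord * -1 : (↥M.Kdd)ˣ) : M.Kdd) : PadicAlgCl p) =
        -((τ.coord : M.Kdd) : PadicAlgCl p) := by
      push_cast; ring
    rw [hcoe]
    exact ⟨fun h => h2 (by rw [← h, neg_neg]), fun h => h1 (neg_injective h)⟩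

/-- **Anchored standard data with the deck relation from ONE anchored point**: given `√−1 = i ∈ K`, an
anchored `τ` with `Ü(τ) = i`, an element `ε ∈ Π^tp_X` with `ε·log(Ü) = log(Ü)·κ(−1)` («the deck
transformation negates `Ü`») and Prop. 1.5 (ii), the anchored translate `τ⁻¹ := ε⁻¹·τ` (abc-iut-L2-d1's
`exists_anchoredPoint_translates_of_prop15ii` at `a = 1`, `u₁ = −1`; coordinate `−i = i⁻¹`) completes `τ` to
`AnchoredStandardData` WITH the deck relation `D_{τ⁻¹} = ε⁻¹ D_τ ε` of the K2 routes.
[cite: MochizukiEtTh2009, Def 1.9 p.29] -/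
theorem exists_anchoredStandardData_of_deck (hC : M.toThetaSetting.Compat)
    {E : M.toThetaSetting.KummerData} (h15ii : ThetaSetting.Prop15ii E hC)
    (i : PadicAlgCl p) (hiK : i ∈ M.K) (hi : i ^ 2 = -1)
    (τ : ThetaSetting.AnchoredPoint E) (hτ : ((τ.coord : M.Kdd) : PadicAlgCl p) = i) (ε : M.PiTemp)
    (hε : haveI := hC.GtpYdd_normal
      ContH1.conj M.toTheta M.toThetaSetting.DeltaTheta ε
          (M.toThetaSetting.inflTheta M.toThetaSetting.GtpYdd E.logUdd) =
        M.toThetaSetting.inflTheta M.toThetaSetting.GtpYdd E.logUdd *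
          M.toThetaSetting.inflTheta M.toThetaSetting.GtpYdd (E.kumYdd (E.toKddHat (-1)))) :
    ∃ A : M.AnchoredStandardData E, A.tau = τ ∧ A.sqrtNegOne = i ∧
      A.tauInv.Dpt = τ.Dpt.comap (MulAut.conj ε).toMonoidHom := by
  haveI := hC.GtpYdd_normal
  obtain ⟨τ_, hD, hc, -⟩ := M.exists_anchoredPoint_translates_of_prop15ii hC h15ii τ ε (-1) hε
    (coord_mul_neg_one_zpow_ne_cusp τ.toNonCuspidalPoint)
  have hinv : i⁻¹ = -i := by
    refine inv_eq_of_mul_eq_one_right ?_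
    linear_combination (-1 : PadicAlgCl p) * hi
  have hcoe : (((τ_ 1).coord : M.Kdd) : PadicAlgCl p) = i⁻¹ := by
    rw [hc 1, zpow_one, hinv, ← hτ]; push_cast; ring
  exact ⟨{ sqrtNegOne := i
           sqrtNegOne_mem := hiK
           sqrtNegOne_sq := hi
           tau := τ
           tauInv := τ_ 1
           tau_coord := hτ
           tauInv_coord := hcoe }, rfl, rfl, by rw [hD 1, zpow_one]⟩

/-- **[EtTh] Thm. 1.10 (i) «up to ±1» from ONE anchored point**: with `√−1 = i ∈ K`, an anchored `τ`
with `Ü(τ) = i`, a degree-`0` element `ε` with `ε·log(Ü) = log(Ü)·κ(−1)`, and the FACTS Prop. 1.5 (ii),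
(iii): the anchored standard data completed by `τ⁻¹ := ε⁻¹·τ` satisfy `Thm110iUnique` (r8″, p425484).
[cite: MochizukiEtTh2009, Thm 1.10 (i) p.29] -/
theorem exists_thm110iUnique_of_anchoredPoint_of_deck (hC : M.toThetaSetting.Compat) {εZ : M.GtpC}
    (hZ : M.IsAdmissibleEpsZ εZ) (E : M.toThetaSetting.EtaleThetaData)
    (h15ii : ThetaSetting.Prop15ii E.toKummerData hC) (h15iii : ThetaSetting.Prop15iii E hC)
    (i : PadicAlgCl p) (hiK : i ∈ M.K) (hi : i ^ 2 = -1)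
    (τ : ThetaSetting.AnchoredPoint E.toKummerData) (hτ : ((τ.coord : M.Kdd) : PadicAlgCl p) = i)
    (ε : M.PiTemp) (hεZ : M.toZ ε = 1)
    (hε : haveI := hC.GtpYdd_normal
      ContH1.conj M.toTheta M.toThetaSetting.DeltaTheta ε
          (M.toThetaSetting.inflTheta M.toThetaSetting.GtpYdd E.logUdd) =
        M.toThetaSetting.inflTheta M.toThetaSetting.GtpYdd E.logUdd *
          M.toThetaSetting.inflTheta M.toThetaSetting.GtpYdd (E.kumYdd (E.toKddHat (-1)))) :
    ∃ A : M.AnchoredStandardData E.toKummerData, A.tau = τ ∧ A.sqrtNegOne = i ∧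
      Thm110iUnique hC hZ E A.toStandardData := by
  obtain ⟨A, hA, hAi, hD⟩ := exists_anchoredStandardData_of_deck hC h15ii i hiK hi τ hτ ε hε
  refine ⟨A, hA, hAi, thm110iUnique_anchored_of_deck hC hZ E A h15ii h15iii ⟨ε, hεZ, ?_⟩⟩
  rw [hD, hA]

end MuTwoSetting

end Literature.AnabelianGeometry.EtaleTheta

end
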